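import Summits.HodgeConjecture.HodgeConjecture.Theorems.CyclicUnitaryPowersHodgeFixedLine

/-!
# The Deligne torus element `h_ℂ(u, u⁻¹)` lies in the connected deck-unitary group `U⁰(ℂ)`, fixes the Hodge
# tensors, and has block determinants `u ^ (2 e_{j,0} - 2 e_{j,2})`

Helper for stub T `stub_unitaryTorusLemma` of the crux `PowersHodgeOfDeckCommutators` (stmt-HodgeConjecture-19545,
route `CyclicUnitaryPowers`, line `unitary-kunneth-fft` v6, lane 2 — "the lever": the Hodge group of the deck-unitary
Hodge structure is the whole `U⁰`).  For a weight-`2` Hodge structure `H` on `V` with `F³ = 0` (so only the pieces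
`(2,0), (1,1), (0,2)` occur, `CyclicUnitaryPowersHodgeFixedLine`), an endomorphism `s` of the Hodge structure and the
complex points `h_u := h_ℂ(u, u⁻¹)` (`u ∈ ℂˣ`) of the Deligne torus (`Motives/HodgeStructureDeligneTorus`, acting on
`V^{a,b}` by `u ^ (a - b)`):

* §3 `h_u` commutes with `s_ℂ`, preserves `Q_ℂ` for a form `Q` with the first Hodge–Riemann relation, is the identity
  on `ker (s_ℂ - 1)` — i.e. `h_u ∈ U⁰(ℂ) = centIso s_ℂ Q_ℂ` (`hodgeTorusC_mem_centIso`) — and fixes `ι t` for every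
  Hodge tensor `t ∈ T^{r,0} V` of type `(r,r)` (the tree's `tensorSpaceActOver_hodgeTorusC_of_mem_hodgeClasses`);
* §4 **block determinants**: `det (h_u ∘ P_j + (1 - P_j)) = u ^ (2 dim (E_j ∩ V^{2,0})) · u⁻¹ ^ (2 dim (E_j ∩ V^{0,2}))`
  on every eigenblock `E_j = range P_j` of `s_ℂ` (`det_hodgeTorusC_block`), by the block product formula of
  `CyclicUnitaryPowersBlockScalars` over the three commuting idempotents `π_a P_j`.
-/

noncomputable section

open Module
open scoped TensorProduct BigOperators

namespace Summit.HodgeConjecture.HodgeConjecture.Theorems.CyclicUnitaryPowersHodgeTorusDeck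

open Literature.AlgebraicGeometry.Motives
open Literature.AlgebraicGeometry.Motives.HodgeStructure
open Summit.HodgeConjecture.HodgeConjecture.Theorems.CyclicUnitaryPowersSpectralProjectors
open Summit.HodgeConjecture.HodgeConjecture.Theorems.CyclicUnitaryPowersBlockScalars
open Summit.HodgeConjecture.HodgeConjecture.Theorems.CyclicUnitaryPowersDeckUnitaryGroup
open Summit.HodgeConjecture.HodgeConjecture.Theorems.CyclicUnitaryPowersHodgeFixedLine

universe u

variable {V : Type u} [AddCommGroup V] [Module ℚ V] {n : ℤ}

/-! ### §3 The torus element `h_ℂ(u, u⁻¹)` is in `U⁰(ℂ)` and fixes the Hodge tensors -/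

section Torus

variable (H : HodgeStructure V n)

/-- `h_ℂ(z, w)` commutes with the complexification of an endomorphism of the Hodge structure. [folklore] -/
theorem hodgeTorusC_baseChange (f : Hom H H) (zw : ℂˣ × ℂˣ) (x : ℂ ⊗[ℚ] V) :
    H.hodgeTorusC zw (f.toLinearMap.baseChange ℂ x) = f.toLinearMap.baseChange ℂ (H.hodgeTorusC zw x) :=
  (f.baseChange_hodgeTorusC zw x).symm

/-- **`h_ℂ(u, u⁻¹)` preserves `Q_ℂ`** for a form `Q` with the first Hodge–Riemann relation in the shape of the K2-A
stubs (`Q_ℂ(F^a, F^b) = 0` for `a + b ≥ 3`, weight `2`). [folklore] -/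
theorem hodgeTorusC_isometry (hn : n = 2) (Q : LinearMap.BilinForm ℚ V)
    (hQF : ∀ (a b : ℤ) (x y : ℂ ⊗[ℚ] V), x ∈ H.F a → y ∈ H.F b → 3 ≤ a + b → Q.baseChange ℂ x y = 0)
    (u : ℂˣ) (x y : ℂ ⊗[ℚ] V) :
    Q.baseChange ℂ (H.hodgeTorusC (u, u⁻¹) x) (H.hodgeTorusC (u, u⁻¹) y) = Q.baseChange ℂ x y := by
  have hHR : ∀ p : ℤ, ∀ x ∈ H.F p, ∀ y ∈ H.F (n + 1 - p), Q.baseChange ℂ x y = 0 :=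
    fun p x hx y hy => hQF p (n + 1 - p) x y hx hy (by omega)
  rw [baseChange_hodgeTorusC_hodgeTorusC_of_HR H Q hHR, Units.mul_inv, one_zpow, one_mul]

/-- **`h_ℂ(u, u⁻¹)` is the identity on the `s_ℂ`-fixed line** (which is of type `(1,1)`). [folklore] -/
theorem hodgeTorusC_apply_of_fixed (hn : n = 2) (f : Hom H H) {p : ℕ} (hp : 0 < p) (hsp : f.toLinearMap ^ p = 1)
    (h1 : Module.finrank ℚ ↥(Module.End.eigenspace f.toLinearMap 1) = 1) (u : ℂˣ) {x : ℂ ⊗[ℚ] V}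
    (hx : f.toLinearMap.baseChange ℂ x = x) : H.hodgeTorusC (u, u⁻¹) x = x := by
  rw [hodgeTorusC_apply_of_mem_piece H u u⁻¹ (show (1 : ℤ) + 1 = n by omega)
    (mem_piece_one_one_of_fixed H hn f hp hsp h1 hx), zpow_one, zpow_one, Units.mul_inv, one_smul]

/-- **`h_ℂ(u, u⁻¹) ∈ U⁰(ℂ)`**: it commutes with `s_ℂ`, preserves `Q_ℂ`, and fixes `ker (s_ℂ - 1)`. [folklore] -/
theorem hodgeTorusC_mem_centIso (hn : n = 2) (Q : LinearMap.BilinForm ℚ V)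
    (hQF : ∀ (a b : ℤ) (x y : ℂ ⊗[ℚ] V), x ∈ H.F a → y ∈ H.F b → 3 ≤ a + b → Q.baseChange ℂ x y = 0)
    (f : Hom H H) {p : ℕ} (hp : 0 < p) (hsp : f.toLinearMap ^ p = 1)
    (h1 : Module.finrank ℚ ↥(Module.End.eigenspace f.toLinearMap 1) = 1) (u : ℂˣ) :
    H.hodgeTorusC (u, u⁻¹) ∈ centIso (f.toLinearMap.baseChange ℂ) (Q.baseChange ℂ) :=
  ⟨fun x => hodgeTorusC_baseChange H f (u, u⁻¹) x, fun x y => hodgeTorusC_isometry H hn Q hQF u x y,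
    fun _ hx => hodgeTorusC_apply_of_fixed H hn f hp hsp h1 u hx⟩

/-- **`h_ℂ(u, u⁻¹)` fixes `ι t` for a Hodge tensor `t ∈ T^{r,0} V`** (type `(r,r)`; the Hodge hypothesis in the shape
of the K2-A stubs). [folklore] -/
theorem tensorSpaceActOver_hodgeTorusC_eq_self [HodgeTensorFacts.{u, u}] [Module.Finite ℚ V] {r : ℕ}
    {t : hodgeTensorSpace V r 0}
    (ht : ∃ p' : ℤ, ((r : ℤ) - ((0 : ℕ) : ℤ)) * n = 2 * p' ∧ t ∈ (H.tensorSpace r 0).hodgeClasses p') (u : ℂˣ) :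
    tensorSpaceActOver (H.hodgeTorusC (u, u⁻¹)) (tensorSpaceToBaseChange ℂ V r 0 t) =
      tensorSpaceToBaseChange ℂ V r 0 t := by
  obtain ⟨p', hp', ht⟩ := ht
  rw [tensorSpaceActOver_hodgeTorusC_of_mem_hodgeClasses H (a := r) (b := 0) (p := p') (by push_cast at hp' ⊢; omega)
    ht u u⁻¹, Units.mul_inv, one_zpow, one_smul]

end Torus

/-! ### §4 Block determinants of `h_ℂ(u, u⁻¹)` on the eigenblocks of `s_ℂ` -/

section BlockDet

variable (H : HodgeStructure V n) (f : Hom H H) {ζ : ℂ} {p : ℕ}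

/-- The Hodge projections commute with `s_ℂ`. [folklore] -/
theorem pieceProj_mul_baseChange (a : ℤ) :
    H.pieceProj a * f.toLinearMap.baseChange ℂ = f.toLinearMap.baseChange ℂ * H.pieceProj a := by
  refine LinearMap.ext fun x => ?_
  rw [Module.End.mul_apply, Module.End.mul_apply, f.baseChange_pieceProj]

/-- The Hodge projections commute with the spectral projectors of `s_ℂ`. [folklore] -/
theorem pieceProj_mul_specProj (a : ℤ) (j : ℕ) :
    H.pieceProj a * specProj (f.toLinearMap.baseChange ℂ) ζ p j = specProj (f.toLinearMap.baseChange ℂ) ζ p j * H.pieceProj a :=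
  commute_specProj (H.pieceProj a) (pieceProj_mul_baseChange H f a) j

/-- `h_ℂ(z, w)` commutes with the spectral projectors of `s_ℂ`. [folklore] -/
theorem hodgeTorusC_mul_specProj (zw : ℂˣ × ℂˣ) (j : ℕ) :
    (H.hodgeTorusC zw : ℂ ⊗[ℚ] V →ₗ[ℂ] ℂ ⊗[ℚ] V) * specProj (f.toLinearMap.baseChange ℂ) ζ p j =
      specProj (f.toLinearMap.baseChange ℂ) ζ p j * (H.hodgeTorusC zw : ℂ ⊗[ℚ] V →ₗ[ℂ] ℂ ⊗[ℚ] V) :=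
  commute_specProj _ (LinearMap.ext fun x => hodgeTorusC_baseChange H f zw x) j

/-- `h_ℂ(z, w) π_a = (z^a w^{n-a}) π_a`. [folklore] -/
theorem hodgeTorusC_mul_pieceProj (zw : ℂˣ × ℂˣ) (a : ℤ) :
    (H.hodgeTorusC zw : ℂ ⊗[ℚ] V →ₗ[ℂ] ℂ ⊗[ℚ] V) * H.pieceProj a = ((torusChar n zw a : ℂˣ) : ℂ) • H.pieceProj a := by
  refine LinearMap.ext fun x => ?_
  rw [Module.End.mul_apply, LinearMap.smul_apply, LinearEquiv.coe_coe, hodgeTorusC_apply, pieceAut_pieceProj]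

/-- `π_a h_ℂ(z, w) = (z^a w^{n-a}) π_a`. [folklore] -/
theorem pieceProj_mul_hodgeTorusC (zw : ℂˣ × ℂˣ) (a : ℤ) :
    H.pieceProj a * (H.hodgeTorusC zw : ℂ ⊗[ℚ] V →ₗ[ℂ] ℂ ⊗[ℚ] V) = ((torusChar n zw a : ℂˣ) : ℂ) • H.pieceProj a := by
  refine LinearMap.ext fun x => ?_
  rw [Module.End.mul_apply, LinearMap.smul_apply, LinearEquiv.coe_coe, hodgeTorusC_apply, pieceProj_pieceAut]

/-- Product of two blocks `(A P) (B P) = (A B) P` for `B` commuting with the idempotent `P`. [folklore] -/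
theorem mul_proj_mul_mul_proj {M : Type*} [Monoid M] {A B P : M} (hBP : B * P = P * B) (hPP : P * P = P) :
    A * P * (B * P) = A * B * P := by
  rw [mul_assoc, ← mul_assoc P B P, ← hBP, mul_assoc B P P, hPP, ← mul_assoc]

/-- `h` commutes with the block idempotent `π_a P_j`. [folklore] -/
theorem hodgeTorusC_comm_blockProj (zw : ℂˣ × ℂˣ) (a : ℤ) (j : ℕ) :
    (H.hodgeTorusC zw : ℂ ⊗[ℚ] V →ₗ[ℂ] ℂ ⊗[ℚ] V) * (H.pieceProj a * specProj (f.toLinearMap.baseChange ℂ) ζ p j) =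
      H.pieceProj a * specProj (f.toLinearMap.baseChange ℂ) ζ p j * (H.hodgeTorusC zw : ℂ ⊗[ℚ] V →ₗ[ℂ] ℂ ⊗[ℚ] V) := by
  rw [← mul_assoc, hodgeTorusC_mul_pieceProj, smul_mul_assoc, mul_assoc (H.pieceProj a),
    ← hodgeTorusC_mul_specProj H f zw j, ← mul_assoc, pieceProj_mul_hodgeTorusC, smul_mul_assoc]

/-- The block idempotents `π_a P_j` are idempotent. [folklore] -/
theorem blockProj_mul_self (hσ : f.toLinearMap.baseChange ℂ ^ p = 1) (hζ : IsPrimitiveRoot ζ p) (hp : 0 < p) (a : ℤ) (j : ℕ) :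
    H.pieceProj a * specProj (f.toLinearMap.baseChange ℂ) ζ p j * (H.pieceProj a * specProj (f.toLinearMap.baseChange ℂ) ζ p j) =
      H.pieceProj a * specProj (f.toLinearMap.baseChange ℂ) ζ p j := by
  rw [mul_proj_mul_mul_proj (pieceProj_mul_specProj H f a j) (isIdempotentElem_specProj hσ hζ hp j).eq,
    pieceProj_mul_pieceProj, if_pos rfl]

/-- The block idempotents `π_a P_j`, `π_b P_j` (`a ≠ b`) are orthogonal. [folklore] -/
theorem blockProj_mul_blockProj_of_ne (hσ : f.toLinearMap.baseChange ℂ ^ p = 1) (hζ : IsPrimitiveRoot ζ p) (hp : 0 < p)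
    {a b : ℤ} (hab : a ≠ b) (j : ℕ) :
    H.pieceProj a * specProj (f.toLinearMap.baseChange ℂ) ζ p j * (H.pieceProj b * specProj (f.toLinearMap.baseChange ℂ) ζ p j) = 0 := by
  rw [mul_proj_mul_mul_proj (pieceProj_mul_specProj H f b j) (isIdempotentElem_specProj hσ hζ hp j).eq,
    pieceProj_mul_pieceProj, if_neg hab, zero_mul]

/-- The range of `π_a P_j` is `E_j ∩ V^{a,n-a}`. [folklore] -/
theorem range_pieceProj_mul_specProj (hσ : f.toLinearMap.baseChange ℂ ^ p = 1) (hζ : IsPrimitiveRoot ζ p) (hp : 0 < p)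
    (a : ℤ) (j : ℕ) :
    LinearMap.range (H.pieceProj a * specProj (f.toLinearMap.baseChange ℂ) ζ p j) =
      LinearMap.range (specProj (f.toLinearMap.baseChange ℂ) ζ p j) ⊓ H.piece a (n - a) := by
  apply le_antisymm
  · rintro _ ⟨y, rfl⟩
    refine ⟨?_, ?_⟩
    · rw [pieceProj_mul_specProj H f a j, Module.End.mul_apply]
      exact LinearMap.mem_range_self _ _
    · rw [Module.End.mul_apply]
      exact pieceProj_mem H a _
  · rintro x ⟨⟨y, rfl⟩, hxa⟩
    refine ⟨specProj (f.toLinearMap.baseChange ℂ) ζ p j y, ?_⟩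
    have h2 : specProj (f.toLinearMap.baseChange ℂ) ζ p j (specProj (f.toLinearMap.baseChange ℂ) ζ p j y) =
        specProj (f.toLinearMap.baseChange ℂ) ζ p j y := by
      rw [← Module.End.mul_apply, (isIdempotentElem_specProj hσ hζ hp j).eq]
    rw [Module.End.mul_apply, h2, pieceProj_apply_of_mem H hxa]

variable [Module.Finite ℚ V]

/-- `det (c • P + (1 - P)) = c ^ dim (range P)` for an idempotent `P`. [folklore] -/
theorem det_smul_proj_add_one_sub {P : Module.End ℂ (ℂ ⊗[ℚ] V)} (hP : IsIdempotentElem P) (c : ℂ) :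
    LinearMap.det (c • P + (1 - P)) = c ^ Module.finrank ℂ ↥(LinearMap.range P) := by
  have hc : (c • (1 : Module.End ℂ (ℂ ⊗[ℚ] V))) * P = P * (c • 1) := by
    rw [smul_mul_assoc, mul_smul_comm, one_mul, mul_one]
  have h1 : c • P + (1 - P) = (c • (1 : Module.End ℂ (ℂ ⊗[ℚ] V))) * P + (1 - P) := by rw [smul_mul_assoc, one_mul]
  rw [h1, det_mul_proj_add_one_sub hP hc]
  have hres : (c • (1 : Module.End ℂ (ℂ ⊗[ℚ] V))).restrict (mapsTo_range_of_commute hc) = c • LinearMap.id := by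
    ext ⟨x, hx⟩
    rfl
  rw [hres, LinearMap.det_smul, LinearMap.det_id, mul_one]

/-- The determinant of one block factor `h (π_a P_j) + (1 - π_a P_j)`. [folklore] -/
theorem det_hodgeTorusC_blockProj_factor (hσ : f.toLinearMap.baseChange ℂ ^ p = 1) (hζ : IsPrimitiveRoot ζ p) (hp : 0 < p)
    (zw : ℂˣ × ℂˣ) (a : ℤ) (j : ℕ) :
    LinearMap.det ((H.hodgeTorusC zw : ℂ ⊗[ℚ] V →ₗ[ℂ] ℂ ⊗[ℚ] V) * (H.pieceProj a * specProj (f.toLinearMap.baseChange ℂ) ζ p j) +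
        (1 - H.pieceProj a * specProj (f.toLinearMap.baseChange ℂ) ζ p j)) =
      ((torusChar n zw a : ℂˣ) : ℂ) ^
        Module.finrank ℂ ↥(LinearMap.range (specProj (f.toLinearMap.baseChange ℂ) ζ p j) ⊓ H.piece a (n - a)) := by
  rw [← mul_assoc, hodgeTorusC_mul_pieceProj, smul_mul_assoc,
    det_smul_proj_add_one_sub (blockProj_mul_self H f hσ hζ hp a j), range_pieceProj_mul_specProj H f hσ hζ hp a j]

/-- **Block determinants of the torus element**: on the eigenblock `E_j = range P_j` of `s_ℂ`,
`det (h_ℂ(u,u⁻¹) ∘ P_j + (1 - P_j)) = u ^ (2 dim (E_j ∩ V^{2,0})) · (u⁻¹) ^ (2 dim (E_j ∩ V^{0,2}))`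
(weight `2`, `F³ = 0`). [folklore] -/
theorem det_hodgeTorusC_block (hn : n = 2) (hF3 : H.F 3 = ⊥) (hσ : f.toLinearMap.baseChange ℂ ^ p = 1)
    (hζ : IsPrimitiveRoot ζ p) (hp : 0 < p) (u : ℂˣ) (j : ℕ) :
    LinearMap.det ((H.hodgeTorusC (u, u⁻¹) : ℂ ⊗[ℚ] V →ₗ[ℂ] ℂ ⊗[ℚ] V) ∘ₗ specProj (f.toLinearMap.baseChange ℂ) ζ p j +
        (1 - specProj (f.toLinearMap.baseChange ℂ) ζ p j)) =
      (u : ℂ) ^ (2 * Module.finrank ℂ ↥(LinearMap.range (specProj (f.toLinearMap.baseChange ℂ) ζ p j) ⊓ H.piece 2 0)) *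
        ((u⁻¹ : ℂˣ) : ℂ) ^ (2 * Module.finrank ℂ ↥(LinearMap.range (specProj (f.toLinearMap.baseChange ℂ) ζ p j) ⊓ H.piece 0 2)) := by
  subst hn
  -- the block product formula over the three idempotents `π_a P_j`, `a = 0, 1, 2`
  have hprod := prod_block_factor (H.hodgeTorusC (u, u⁻¹) : ℂ ⊗[ℚ] V →ₗ[ℂ] ℂ ⊗[ℚ] V)
    (fun a : ℕ => H.pieceProj (a : ℤ) * specProj (f.toLinearMap.baseChange ℂ) ζ p j) (List.range 3) List.nodup_range
    (fun a => hodgeTorusC_comm_blockProj H f (u, u⁻¹) (a : ℤ) j)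
    (fun a _ => blockProj_mul_self H f hσ hζ hp (a : ℤ) j)
    (fun a _ b _ hab => blockProj_mul_blockProj_of_ne H f hσ hζ hp (by exact_mod_cast hab) j)
  have hsum : ((List.range 3).map fun a : ℕ => H.pieceProj (a : ℤ) * specProj (f.toLinearMap.baseChange ℂ) ζ p j).sum =
      specProj (f.toLinearMap.baseChange ℂ) ζ p j := by
    rw [list_range_map_sum, Finset.sum_range_succ, Finset.sum_range_succ, Finset.sum_range_succ, Finset.sum_range_zero,
      zero_add, ← add_mul, ← add_mul, Nat.cast_zero, Nat.cast_one, Nat.cast_ofNat,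
      pieceProj_zero_add_one_add_two H rfl hF3, one_mul]
  rw [hsum] at hprod
  rw [← Module.End.mul_eq_comp, ← hprod, map_list_prod]
  -- evaluate the three factors
  rw [show List.range 3 = [0, 1, 2] from rfl]
  simp only [List.map_cons, List.map_nil, List.prod_cons, List.prod_nil, mul_one]
  rw [det_hodgeTorusC_blockProj_factor H f hσ hζ hp, det_hodgeTorusC_blockProj_factor H f hσ hζ hp,
    det_hodgeTorusC_blockProj_factor H f hσ hζ hp, coe_torusChar_apply, coe_torusChar_apply, coe_torusChar_apply,
    Nat.cast_zero, Nat.cast_one, Nat.cast_ofNat, zpow_zero, one_mul, sub_zero, zpow_one,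
    show (2 : ℤ) - 1 = 1 by norm_num, zpow_one, Units.mul_inv, one_pow, one_mul, sub_self, zpow_zero, mul_one,
    mul_comm]
  simp only [zpow_ofNat, ← pow_mul]

end BlockDet

end Summit.HodgeConjecture.HodgeConjecture.Theorems.CyclicUnitaryPowersHodgeTorusDeck

end
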